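import Mathlib
import HarnessLib
import Summits.KontsevichZagierPeriods.KontsevichZagierPeriods.Theorems.LinRedNormalFormResidualBeyondGenusZeroDimOneSplit

/-!
# Route LinRedNormalForm, item `ResidualBeyondGenusZero` (stmt-KontsevichZagierPeriods-3917): the TRANSFER form of the one-dimensional separation

The dimension-one split of the declared residual `ResidualBeyondGenusZero` (RES) reads
`RES ⇐ DimOneKernelInKZ ∧ (Mix) ∧ RES₁` (`LinRedNormalFormResidualBeyondGenusZeroDimOneSplit.lean`,
`…DimOnePieces.lean`), where (Mix) = `DimOneSeparation` says: a vanishing element of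
`closure (gzSet ∪ range of₁)` is, modulo `KZ.relations`, a genus-zero combination plus a VANISHING
one-dimensional combination.

This file records the sharpest reading of (Mix), at the level of MOVES between the two sectors:

* `mix_iff_transfer` — (Mix) is EQUIVALENT to (Transfer): for every real number `v` that is at once
  the value of a `ℤ`-combination of genus-zero representations and the value of a `ℤ`-combination
  of one-dimensional representations, SOME genus-zero representative `z` of `v` and SOME
  one-dimensional representative `y` of `v` are congruent modulo `KZ.relations`.
  So the whole content of piece 2 of the split sits on the COMMON VALUES of the two sectors.
* `transfer_ratCast` — (Transfer) at every rational `v`, unconditionally and with no move: the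
  constant representation `[Δ₁, q]` is genus-zero and one-dimensional at once.
* `transfer_of_ratValues` — hence (Transfer), and so (Mix), from the value-level statement
  "every common value of the two sectors is rational" (the sector's transcendence input; by Brown's
  theorem the genus-zero values are `ℚ`-combinations of `1` and multiple zeta values, of weight
  `≥ 2` off the constants, while one-dimensional values are real periods of curve type).
* `transfer_of_jointKernel`, `transfer_of_residualBeyondGenusZero` — (Transfer) from the kernel
  form of Conjecture 1 on the joint sector (take `z = g`, `y = h`), and from RES itself; so
  (Transfer) is summit-implied, as a piece of a lossless split must be.

Reading: conjecturally the two sectors share NO irrational value, so (Transfer) has no non-vacuous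
instance to prove; every proof of piece 2 is therefore either the transcendence statement of
`transfer_of_ratValues` or a fragment of Conjecture 1 (`transfer_of_jointKernel`). Nothing here
attacks RES (declared residual, summit-strength: `LinRedNormalFormResidualBeyondGenusZeroStrength.lean`).

References: M. Kontsevich, D. Zagier, *Periods* (2001), §1.2; F. Brown, *Multiple zeta values and
periods of moduli spaces `𝔐₀,ₙ`*, Ann. Sci. ÉNS 42 (2009), Thm 1.1; A. Huber, G. Wüstholz,
*Transcendence and Linear Relations of 1-Periods* (2022), Ch. 13.
-/

noncomputable section

namespace Summit.KontsevichZagierPeriods.ResidualBeyondGenusZero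

open Literature.NumberTheory.Transcendental
open Summit.KontsevichZagierPeriods.KontsevichZagierPeriods.Theses.LinRedNormalForm (ResidualBeyondGenusZero)
open Summit.KontsevichZagierPeriods.SymplecticScissors.RealOnePeriodRelationsNegative (H₁)
open Summit.KontsevichZagierPeriods.DihedralNormalForm.Negative (oneRep)

/-- **(Mix) ⟺ (Transfer).** The separation statement (Mix) of the dimension-one split — every
vanishing element of `closure (gzSet ∪ range of₁)` is, modulo `KZ.relations`, a genus-zero
combination plus a vanishing one-dimensional combination — is equivalent to the TRANSFER of common
values: whenever a real `v` is the value of a genus-zero combination and of a one-dimensional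
combination, some genus-zero representative `z` and some one-dimensional representative `y` of `v`
satisfy `y - z ∈ KZ.relations`.
(⇒) apply (Mix) to `g - h` and read off `z = g - g₀`, `y = h + h₀` (soundness forces `eval g₀ = 0`);
(⇐) split `m = g + h` along `closure (A ∪ B) = closure A ⊔ closure B`, transfer `v = eval g`
(represented one-dimensionally by `-h`), and move the pair across: `m = (g - z) + (h + y) + (z - y)`.
[folklore] -/
theorem mix_iff_transfer :
    (∀ m ∈ AddSubgroup.closure (Negative.gzSet ∪ Set.range fun r : KZ.IntegralRep 1 => KZ.of r),
      KZ.eval m = 0 → ∃ g ∈ AddSubgroup.closure Negative.gzSet, ∃ h ∈ H₁,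
        KZ.eval h = 0 ∧ m - g - h ∈ KZ.relations) ↔
    (∀ v : ℝ, (∃ g ∈ AddSubgroup.closure Negative.gzSet, KZ.eval g = v) →
      (∃ h ∈ H₁, KZ.eval h = v) →
      ∃ z ∈ AddSubgroup.closure Negative.gzSet, ∃ y ∈ H₁, KZ.eval z = v ∧ y - z ∈ KZ.relations) := by
  constructor
  · rintro hMix v ⟨g, hg, hgv⟩ ⟨h, hh, hhv⟩
    have hh' : h ∈ AddSubgroup.closure (Set.range fun r : KZ.IntegralRep 1 => KZ.of r) := hh
    have hm : g - h ∈
        AddSubgroup.closure (Negative.gzSet ∪ Set.range fun r : KZ.IntegralRep 1 => KZ.of r) :=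
      sub_mem (AddSubgroup.closure_mono Set.subset_union_left hg)
        (AddSubgroup.closure_mono Set.subset_union_right hh')
    have hm0 : KZ.eval (g - h) = 0 := by rw [map_sub, hgv, hhv, sub_self]
    obtain ⟨g₀, hg₀, h₀, hh₀, hh₀0, hrel⟩ := hMix (g - h) hm hm0
    have hg₀0 : KZ.eval g₀ = 0 := by
      have e : KZ.eval (g - h - g₀ - h₀) = 0 :=
        (AddMonoidHom.mem_ker).1 (KZ.relations_le_ker_eval_holds hrel)
      rw [map_sub, map_sub, hm0, hh₀0, zero_sub, sub_zero, neg_eq_zero] at e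
      exact e
    refine ⟨g - g₀, sub_mem hg hg₀, h + h₀, add_mem hh hh₀, ?_, ?_⟩
    · rw [map_sub, hgv, hg₀0, sub_zero]
    · have e : h + h₀ - (g - g₀) = -(g - h - g₀ - h₀) := by abel
      rw [e]
      exact neg_mem hrel
  · intro hT m hm hm0
    rw [AddSubgroup.closure_union] at hm
    obtain ⟨g, hg, h, hh, rfl⟩ := AddSubgroup.mem_sup.mp hm
    rw [map_add] at hm0
    have hh' : h ∈ H₁ := hh
    obtain ⟨z, hz, y, hy, hzv, hyz⟩ :=
      hT (KZ.eval g) ⟨g, hg, rfl⟩ ⟨-h, neg_mem hh', by rw [map_neg]; linarith⟩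
    have hyv : KZ.eval y = KZ.eval g := by
      have e : KZ.eval (y - z) = 0 := (AddMonoidHom.mem_ker).1 (KZ.relations_le_ker_eval_holds hyz)
      rw [map_sub, sub_eq_zero] at e
      rw [e, hzv]
    refine ⟨g - z, sub_mem hg hz, h + y, add_mem hh' hy, ?_, ?_⟩
    · rw [map_add, hyv]
      linarith
    · have e : g + h - (g - z) - (h + y) = -(y - z) := by abel
      rw [e]
      exact neg_mem hyz

/-- **(Transfer) at a rational value, unconditionally.** The constant representation `[Δ₁, q]` is
a genus-zero generator (`of_constMul_oneRep_mem_gzSet`) and one-dimensional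
(`of_constMul_oneRep_mem_H₁`) with value `q`; take `z = y = [Δ₁, q]`, so `y - z = 0`. [folklore] -/
theorem transfer_ratCast (q : ℚ) :
    ∃ z ∈ AddSubgroup.closure Negative.gzSet, ∃ y ∈ H₁,
      KZ.eval z = (q : ℝ) ∧ y - z ∈ KZ.relations :=
  ⟨KZ.of (oneRep.constMul (q : ℝ) (isAlgebraic_algebraMap q)),
    AddSubgroup.subset_closure (of_constMul_oneRep_mem_gzSet q),
    KZ.of (oneRep.constMul (q : ℝ) (isAlgebraic_algebraMap q)), of_constMul_oneRep_mem_H₁ q,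
    eval_of_constMul_oneRep q, by rw [sub_self]; exact zero_mem _⟩

/-- **(Transfer) from rational common values.** If every real number that is at once a genus-zero
combination value and a one-dimensional combination value is rational (the sector's transcendence
input, period-conjecture strength; NOT implied by the summit as formalised), then (Transfer) holds
by `transfer_ratCast` — hence (Mix) by `mix_iff_transfer` (cf. `mix_of_ratValues`). [folklore] -/
theorem transfer_of_ratValues
    (hV : ∀ v : ℝ, (∃ g ∈ AddSubgroup.closure Negative.gzSet, KZ.eval g = v) →
      (∃ h ∈ H₁, KZ.eval h = v) → ∃ q : ℚ, v = q) :
    ∀ v : ℝ, (∃ g ∈ AddSubgroup.closure Negative.gzSet, KZ.eval g = v) →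
      (∃ h ∈ H₁, KZ.eval h = v) →
      ∃ z ∈ AddSubgroup.closure Negative.gzSet, ∃ y ∈ H₁, KZ.eval z = v ∧ y - z ∈ KZ.relations := by
  intro v hg hh
  obtain ⟨q, rfl⟩ := hV v hg hh
  exact transfer_ratCast q

/-- **(Transfer) from the kernel form of Conjecture 1 on the joint sector.** If every vanishing
element of `closure (gzSet ∪ range of₁)` is a relation, transfer with the given representatives
(`z = g`, `y = h`): `h - g` vanishes, hence is a relation. [folklore] -/
theorem transfer_of_jointKernel
    (hK : ∀ m ∈ AddSubgroup.closure (Negative.gzSet ∪ Set.range fun r : KZ.IntegralRep 1 => KZ.of r),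
      KZ.eval m = 0 → m ∈ KZ.relations) :
    ∀ v : ℝ, (∃ g ∈ AddSubgroup.closure Negative.gzSet, KZ.eval g = v) →
      (∃ h ∈ H₁, KZ.eval h = v) →
      ∃ z ∈ AddSubgroup.closure Negative.gzSet, ∃ y ∈ H₁, KZ.eval z = v ∧ y - z ∈ KZ.relations := by
  rintro v ⟨g, hg, hgv⟩ ⟨h, hh, hhv⟩
  have hh' : h ∈ AddSubgroup.closure (Set.range fun r : KZ.IntegralRep 1 => KZ.of r) := hh
  refine ⟨g, hg, h, hh, hgv, hK (h - g) ?_ ?_⟩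
  · exact sub_mem (AddSubgroup.closure_mono Set.subset_union_right hh')
      (AddSubgroup.closure_mono Set.subset_union_left hg)
  · rw [map_sub, hgv, hhv, sub_self]

/-- **(Transfer) from the declared residual itself** (so from the summit,
`residualBeyondGenusZero_of_kontsevichZagierPeriods`): RES gives (Mix)
(`dimOne_split_of_residualBeyondGenusZero`), and (Mix) is (Transfer) (`mix_iff_transfer`). Recorded
so that the transfer form is certified summit-implied — a legitimate piece of a lossless split.
[folklore] -/
theorem transfer_of_residualBeyondGenusZero (hRES : ResidualBeyondGenusZero) :
    ∀ v : ℝ, (∃ g ∈ AddSubgroup.closure Negative.gzSet, KZ.eval g = v) →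
      (∃ h ∈ H₁, KZ.eval h = v) →
      ∃ z ∈ AddSubgroup.closure Negative.gzSet, ∃ y ∈ H₁, KZ.eval z = v ∧ y - z ∈ KZ.relations :=
  mix_iff_transfer.mp (dimOne_split_of_residualBeyondGenusZero hRES).2

/-- **(Mix) from (Transfer)**, the direction the line uses:the one-dimensional separation follows
from the transfer of common values. [folklore] -/
theorem mix_of_transfer
    (hT : ∀ v : ℝ, (∃ g ∈ AddSubgroup.closure Negative.gzSet, KZ.eval g = v) →
      (∃ h ∈ H₁, KZ.eval h = v) →
      ∃ z ∈ AddSubgroup.closure Negative.gzSet, ∃ y ∈ H₁, KZ.eval z = v ∧ y - z ∈ KZ.relations) :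
    ∀ m ∈ AddSubgroup.closure (Negative.gzSet ∪ Set.range fun r : KZ.IntegralRep 1 => KZ.of r),
      KZ.eval m = 0 → ∃ g ∈ AddSubgroup.closure Negative.gzSet, ∃ h ∈ H₁,
        KZ.eval h = 0 ∧ m - g - h ∈ KZ.relations :=
  mix_iff_transfer.mpr hT

end Summit.KontsevichZagierPeriods.ResidualBeyondGenusZero

end
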